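import Summits.NavierStokesRegularity.NavierStokesRegularity.Theorems.TypeICertificateLadderTargetStrainCubeSharpDepletion
import Summits.NavierStokesRegularity.NavierStokesRegularity.Theorems.TargetDepletionLadderBoundedSobolevData
import HarnessLib

/-!
# Crux `Target` (stmt-NavierStokesRegularity-1217), line `depletion_ladder`, stub S1 (registered class):
# the SHARP depletion inequality `κ = (2+√3)/9` for BOUNDED smooth fields (no `L²` hypothesis on `v`)

`--supports stmt-NavierStokesRegularity-1217` (seat leafhand-ns-poloidalwindowdoor-3 g0, cell decomp-ns; step
(P4) of the registered-class programme for `stub_depletionBelowHalf`, after P1 `…BoundedBiotSavart`,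
P2 `…BoundedDivCurl`, P3 `…BoundedSobolevData` (this seat)).

The tree's `StrainCube.abs_integral_stretching_le_strainCube_sharp` proves
`|∫⟪ω, Dv ω⟫| ≤ ((2+√3)/9)·M·‖ω‖₂·‖∇ω‖₂` for `v ∈ C^∞` divergence free with `‖v‖ ≤ M`, `‖Dv‖ ≤ B` and
`D⁰v, D¹v, D²v ∈ L²`. The hypothesis `D⁰v ∈ L²` (`h0`) enters at ONE place: `‖S‖₂² = ½‖ω‖₂²`
(`integral_sumSq_sym_eq_half`), i.e. the whole-space div–curl identity. For bounded non-decaying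
`v` that identity is P2 (`BoundedDivCurl.integral_frobeniusNormSq_fderiv_eq_of_bounded`), so:

* `integral_sumSq_sym_eq_half_of_bounded` — `∫ Σᵢⱼ sᵢⱼ² = ½ ∫‖curl v‖²` for `v ∈ C^∞` divergence
  free, `‖v‖ ≤ M`, `D¹v ∈ L²` (no `h0`).
* `abs_integral_stretching_le_strainCube_sharp_of_bounded` — **the sharp depletion inequality for
  bounded fields**: `v ∈ C^∞` divergence free, `‖v‖ ≤ M`, `‖Dv‖ ≤ B`, `D¹v, D²v ∈ L²` ⟹
  `|∫⟪curl v, Dv (curl v)⟫| ≤ ((2+√3)/9) · M · √(∫‖curl v‖²) · √(∫|∇ curl v|²_F)` (the tree's proof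
  verbatim with the `h0`-step replaced).
* `abs_integral_stretching_le_sharp_of_registered_smooth` — ★ the registered binders PLUS
  (`u ∈ C^∞`, `‖Du‖ ≤ B`): `|∫⟪ω, Du ω⟫| ≤ ((2+√3)/9) · M · √(∫‖ω‖²) · √(∫|∇ω|²_F)` with `h1`, `h2`
  supplied by P3 (`BoundedSobolevData.registered_sobolev_data`). Since `(2+√3)/9 < 1/2`
  (`sharp_lt_half`), this is `stub_depletionBelowHalf` on the sub-class `C^∞ ∩ {‖Du‖ bounded}` of the
  registered class.

WHAT REMAINS for S1 as registered: remove `C^∞` and `‖Du‖ ≤ B`. Mollification does both at once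
(`u_ε = ρ_ε ⋆ u ∈ C^∞`, `div u_ε = 0`, `‖u_ε‖ ≤ M`, `‖Du_ε‖ ≤ M‖Dρ_ε‖₁`, and by Jensen
`‖curl u_ε‖₂ ≤ ‖curl u‖₂`, `‖∇curl u_ε‖₂ ≤ ‖∇ curl u‖₂` — the right side does not grow), leaving only
`∫⟪ω_ε, Du_ε ω_ε⟫ → ∫⟪ω, Du ω⟫` (`ω, Du ∈ L² ∩ L⁶ ⊂ L³` by Gagliardo–Nirenberg–Sobolev and
`MollifiedLimits.tendsto_eLpNorm_bilin_sub`).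

HONEST LABEL: helper (step P4 of an L/XL programme); closes no stub (the registered S1 quantifies over
`C²` fields with no gradient bound); no Navier–Stokes content; `Target`, S3, NS regularity OPEN.

References: L. Escauriaza's strain form of the stretching (Betchov 1956); tree files
`…StrainCube{Depletion,SharpInterpolation,Identities,SharpDepletion}`. [folklore]
-/

noncomputable section

-- the summit and its single sub-problem share the name (CONVENTIONS §1)
set_option linter.dupNamespace false

open Set Filter Topology MeasureTheory
open scoped RealInnerProductSpace ENNReal NNReal Laplacian ContDiff
open Literature.Analysis.FluidPDE

namespace Summit.NavierStokesRegularity.NavierStokesRegularity.Theorems.DepletionLadder.BoundedSharpDepletion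

open Summit.NavierStokesRegularity.NavierStokesRegularity.Theorems.RungReynoldsOne
open Summit.NavierStokesRegularity.NavierStokesRegularity.Theorems.RungReynoldsOne.WeightedSlice
open Summit.NavierStokesRegularity.NavierStokesRegularity.Theorems.DepletionLadder
open Summit.NavierStokesRegularity.NavierStokesRegularity.Theorems.DepletionLadder.StrainCube
open Summit.NavierStokesRegularity.NavierStokesRegularity.Theorems.DepletionLadder.BoundedDivCurl
open Summit.NavierStokesRegularity.NavierStokesRegularity.Theorems.DepletionLadder.BoundedSobolevData

variable {v : EuclideanSpace ℝ (Fin 3) → EuclideanSpace ℝ (Fin 3)}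
  {s : Fin 3 → Fin 3 → EuclideanSpace ℝ (Fin 3) → ℝ}

/-- `‖curl v‖² ∈ L¹` from `D¹v ∈ L²` (`‖curl v‖ ≤ ‖curlCLM‖ ‖Dv‖`). [folklore] -/
theorem integrable_norm_curl_sq_of_h1 (hv : ContDiff ℝ ∞ v)
    (h1 : ∫⁻ x, ‖iteratedFDeriv ℝ 1 v x‖ₑ ^ 2 < ⊤) :
    Integrable fun x => ‖curl v x‖ ^ 2 := by
  have hv1 : ContDiff ℝ 1 v := hv.of_le (by norm_cast)
  have cC : Continuous fun x => ‖curl v x‖ ^ 2 := (continuous_curl hv1).norm.pow 2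
  refine integrable_of_le_iteratedFDeriv_mul hv h1 h1 cC (‖curlCLM‖ ^ 2) fun x => ?_
  rw [abs_of_nonneg (sq_nonneg _), norm_iteratedFDeriv_one_eq]
  have h := norm_curl_le v x
  have h0' : 0 ≤ ‖curlCLM‖ := norm_nonneg curlCLM
  nlinarith [norm_nonneg (curl v x), norm_nonneg (fderiv ℝ v x)]

/-- **`∫ Σᵢⱼ sᵢⱼ² = ½ ∫‖curl v‖²` without `v ∈ L²`.** For `v ∈ C^∞` divergence free, BOUNDED, with
`D¹v ∈ L²`: the pointwise identity `Σ sᵢⱼ² = |Dv|²_F − ½‖curl v‖²` and the div–curl identity for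
bounded fields `∫|Dv|²_F = ∫‖curl v‖²` (P2). [folklore] -/
theorem integral_sumSq_sym_eq_half_of_bounded (hv : ContDiff ℝ ∞ v) (hdiv : VectorCalculus.IsDivFree v)
    {M : ℝ} (hM : ∀ x, ‖v x‖ ≤ M) (h1 : ∫⁻ x, ‖iteratedFDeriv ℝ 1 v x‖ₑ ^ 2 < ⊤)
    (hs : ∀ i j y, s i j y = (pderiv j (fun z => v z i) y + pderiv i (fun z => v z j) y) / 2) :
    ∫ x, ∑ i, ∑ j, s i j x ^ 2 = (1 / 2) * ∫ x, ‖curl v x‖ ^ 2 := by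
  have hv2 : ContDiff ℝ 2 v := hv.of_le (by norm_cast)
  have iC : Integrable fun x => ‖curl v x‖ ^ 2 := integrable_norm_curl_sq_of_h1 hv h1
  obtain ⟨iF, hid⟩ := registered_gradient_sq_integrable_and_eq hv2 hdiv hM iC
  have hpt : ∀ x, ∑ i, ∑ j, s i j x ^ 2 = frobeniusNormSq (fderiv ℝ v x) - (1 / 2) * ‖curl v x‖ ^ 2 :=
    fun x => by rw [sumSq_sym_eq_frobeniusNormSq_sub hv hs x]; ring
  simp_rw [hpt]
  rw [integral_sub iF (iC.const_mul _), integral_const_mul, hid]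
  ring

/-- **THE SHARP DEPLETION INEQUALITY FOR BOUNDED FIELDS.** For a `C^∞` divergence-free field
`v : ℝ³ → ℝ³` with `‖v‖ ≤ M`, `‖Dv‖ ≤ B` and `D¹v, D²v ∈ L²` (NO square-integrability of `v`):
`|∫⟪curl v, Dv (curl v)⟫| ≤ ((2+√3)/9) · M · √(∫‖curl v‖²) · √(∫|∇ curl v|²_F)`. The tree's proof of
`abs_integral_stretching_le_strainCube_sharp` with `integral_sumSq_sym_eq_half_of_bounded` in place
of the `h0` step. [folklore] -/
theorem abs_integral_stretching_le_strainCube_sharp_of_bounded (hv : ContDiff ℝ ∞ v)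
    (hdiv : VectorCalculus.IsDivFree v)
    {M B : ℝ} (hM : ∀ x, ‖v x‖ ≤ M) (hB : ∀ x, ‖fderiv ℝ v x‖ ≤ B)
    (h1 : ∫⁻ x, ‖iteratedFDeriv ℝ 1 v x‖ₑ ^ 2 < ⊤) (h2 : ∫⁻ x, ‖iteratedFDeriv ℝ 2 v x‖ₑ ^ 2 < ⊤) :
    |∫ x, ⟪curl v x, fderiv ℝ v x (curl v x)⟫| ≤
      (2 + Real.sqrt 3) / 9 * M * Real.sqrt (∫ x, ‖curl v x‖ ^ 2) *
        Real.sqrt (∫ x, frobeniusNormSq (fderiv ℝ (curl v) x)) := by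
  -- adapted from Theorems/TypeICertificateLadderTargetStrainCubeSharpDepletion.lean
  set s : Fin 3 → Fin 3 → EuclideanSpace ℝ (Fin 3) → ℝ :=
    fun i j y => (pderiv j (fun z => v z i) y + pderiv i (fun z => v z j) y) / 2 with hsdef
  have hs : ∀ i j y, s i j y = (pderiv j (fun z => v z i) y + pderiv i (fun z => v z j) y) / 2 :=
    fun i j y => rfl
  have hM0 : 0 ≤ M := (norm_nonneg _).trans (hM 0)
  set Z := ∫ x, ‖curl v x‖ ^ 2 with hZ
  set W := ∫ x, frobeniusNormSq (fderiv ℝ (curl v) x) with hW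
  have hA := abs_integral_stretching_le_integral_cube hv hdiv hM hB h1 hs
  have hI := integral_strainCube_le_sharp hv hdiv hM hB h1 h2 hs
  have e1 : ∫ x, ∑ i, ∑ j, s i j x ^ 2 = (1 / 2) * Z :=
    integral_sumSq_sym_eq_half_of_bounded hv hdiv hM h1 hs
  have e2 : ∫ x, ∑ l, ∑ i, ∑ j, pderiv l (s i j) x ^ 2 = (1 / 2) * W :=
    integral_gradSq_sym_eq_half hv hdiv h1 h2 hs
  have e3 : ∫ x, ‖(Δ v) x‖ ^ 2 = W := integral_norm_laplacian_sq_eq hv hdiv h1 h2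
  rw [e1, e2, e3] at hI
  have hc : 0 ≤ (2 / 9) * Real.sqrt 6 := by positivity
  calc |∫ x, ⟪curl v x, fderiv ℝ v x (curl v x)⟫|
      ≤ (2 / 9) * Real.sqrt 6 * ∫ x, (∑ i, ∑ j, s i j x ^ 2) * Real.sqrt (∑ i, ∑ j, s i j x ^ 2) := hA
    _ ≤ (2 / 9) * Real.sqrt 6 * (M * ((1 / 2) * Real.sqrt W * Real.sqrt ((1 / 2) * Z) +
          Real.sqrt (2 / 3) * Real.sqrt ((1 / 2) * Z) * Real.sqrt ((1 / 2) * W))) :=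
        mul_le_mul_of_nonneg_left hI hc
    _ = (2 + Real.sqrt 3) / 9 * M * Real.sqrt Z * Real.sqrt W := by
        rw [show (2 / 9) * Real.sqrt 6 * (M * ((1 / 2) * Real.sqrt W * Real.sqrt ((1 / 2) * Z) +
            Real.sqrt (2 / 3) * Real.sqrt ((1 / 2) * Z) * Real.sqrt ((1 / 2) * W))) =
            M * ((2 / 9) * Real.sqrt 6 * ((1 / 2) * Real.sqrt W * Real.sqrt ((1 / 2) * Z) +
            Real.sqrt (2 / 3) * Real.sqrt ((1 / 2) * Z) * Real.sqrt ((1 / 2) * W))) by ring,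
          depletion_constant_sharp_eq Z W]
        ring

/-- `(2+√3)/9 < 1/2` (`√3 < 5/2`). [folklore] -/
theorem sharp_lt_half : (2 + Real.sqrt 3) / 9 < 1 / 2 := by
  have h3 : Real.sqrt 3 < 5 / 2 := by
    rw [show (5 / 2 : ℝ) = Real.sqrt ((5 / 2) ^ 2) by rw [Real.sqrt_sq (by norm_num)]]
    exact Real.sqrt_lt_sqrt (by norm_num) (by norm_num)
  linarith

/-- ★ **The sharp depletion inequality on the smooth, bounded-gradient sub-class of the registered
class.** For `u ∈ C^∞(ℝ³; ℝ³)` divergence free with `‖u‖ ≤ M`, `‖Du‖ ≤ B`, `‖curl u‖² ∈ L¹` and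
`|∇ curl u|²_F ∈ L¹` (the registered binders of `StretchingDepletion`, plus smoothness and a gradient
bound; NO decay of `u`):
`|∫⟪ω, Du ω⟫| ≤ ((2+√3)/9) · M · √(∫‖ω‖²) · √(∫|∇ω|²_F)`, `ω = curl u`. The Sobolev data `h1`, `h2`
come from P3. [folklore] -/
theorem abs_integral_stretching_le_sharp_of_registered_smooth
    {u : EuclideanSpace ℝ (Fin 3) → EuclideanSpace ℝ (Fin 3)} (hu : ContDiff ℝ ∞ u)
    (hdiv : VectorCalculus.IsDivFree u) {M B : ℝ} (hM : ∀ x, ‖u x‖ ≤ M)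
    (hB : ∀ x, ‖fderiv ℝ u x‖ ≤ B)
    (hZ : Integrable fun x => ‖curl u x‖ ^ 2)
    (hP : Integrable fun x => frobeniusNormSq (fderiv ℝ (curl u) x)) :
    |∫ x, ⟪curl u x, fderiv ℝ u x (curl u x)⟫| ≤
      (2 + Real.sqrt 3) / 9 * M * Real.sqrt (∫ x, ‖curl u x‖ ^ 2) *
        Real.sqrt (∫ x, frobeniusNormSq (fderiv ℝ (curl u) x)) := by
  have hu2 : ContDiff ℝ 2 u := hu.of_le (by norm_cast)
  obtain ⟨-, h1, h2⟩ := registered_sobolev_data hu2 hdiv hM hZ hP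
  exact abs_integral_stretching_le_strainCube_sharp_of_bounded hu hdiv hM hB h1 h2

end Summit.NavierStokesRegularity.NavierStokesRegularity.Theorems.DepletionLadder.BoundedSharpDepletion

end
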